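import Summits.QuantumFields.BalabanUV.T4Continuum.Spine.NE2BalabanFinal
import Summits.QuantumFields.BalabanUV.T4Continuum.Support.CovariantLaplacianRate
import Summits.QuantumFields.BalabanUV.T4Continuum.Support.AveragingSummandRate
import Summits.QuantumFields.BalabanUV.T4Continuum.Support.GaugeTermSlotRate

/-!
# T⁴ programme, spine node NE2 (U1a), owner row B8 «general rate» (OWNER RULINGS R17 (c) / R19), PART 3, file 3c —
# THE B4 GAUGE SLOT AT A GENERAL RATE `θ` ON REGULAR DATA: the face PART 4 composes with (`kappa4F` / `C4F` letters)

NE2 formalisation swarm `b2b-balaban-t4-ne2-formalise-*`, leaf prover 05 (gen 4; PART 3 holder).  APPEND-ONLY twins, NO landed statement edited;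
the instance of record `NE2BalabanFinal.perturbationLaws_gaugeSlot_regular` (rate `L⁻¹`) is the special case (kernel `example` at the end).
PART 4's assembly (leaf-08-g2, `Spine/NE2BalabanFinalRate`) takes the B4 slot `hP₄` at rate `θ` in the currency `(hreg, hNE3θ)` with leaf-08's
letters `kappa4F` / `C4F`; files 3a / 3b deliver it on ROW DATA (`ConnectionLaws0Rate` / `SiteTransportLaws0Rate`).  This file supplies the two
READ-OUTS of those data shapes from row B5's class + node NE3 AT RATE `θ` and the composed face:
 * §1 **`connectionLaws0Rate_of_regular (hd) (hreg) (hC) (hθ : L⁻¹ ≤ θ) (hNE3θ)`** — twin of `NE2BalabanFinal.connectionLaws0_of_regular`: the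
   connection's two-spacing consistency `βNE3·θ^k` READ OFF node U1b's `LocalRate … C θ` by row B6's GENERAL `NE2FromNE3.consistent_of_localRate`,
   the zeroth-order field's `zetaR·θ^k` by part 1's `CovariantLaplacianRate.matrixBoundsRate_of_regular_of_localRate` (leaf-07-g3) — SAME letters
   `betaNE3`, `zetaR`;
 * §2 **`norm_siteT_succ_sub_par_le_rate … ≤ theta0 d α (βNE3 C)·θ^k`** — leaf-03's `RegularSiteTransporters.norm_siteT_succ_sub_par_le` re-run on
   part 2's `AveragingSummandRate.transport_contour_two_level_of_regular_rate` + `thetaC_rate_le_geom` (leaf-08-g2; SAME closed-form `theta0`), and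
   **`siteTransportLaws0Rate_of_regular … : SiteTransportLaws0Rate L M (siteT L M Rg) (tauR d α) (theta0 d α (βNE3 C)) θ`** (twin of leaf-03's
   `RegularSiteTransportLaws.siteTransportLaws0_of_regular`);
 * §3 **`perturbationLaws_gaugeSlot_regular_rate (hd) (hreg) (hC) (hθ : L⁻¹ ≤ θ) (hθle : θ ≤ 1) (hNE3θ) (ha′) (hκ) (hsmall) :
   PerturbationLaws (Δ_a ⊗ 1) (gaugeSlot L M Rg (QuT L M o (siteT L M Rg)) (Q1 L M o) a′) (J ⊗ 1) (kappa4F d a a′ α β) (k ↦ C4F o d L a a′ α β C · θ^k)`**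
   = 3b-2's `perturbationLaws_gaugeSlot_balabanData_rate` at the two read-outs (`kappa4F` / `C4F` unfold to `kappaGS …` / `C4data …` definitionally,
   exactly as in `NE2BalabanFinal.perturbationLaws_gaugeSlot_regular`).
WHAT IT IS NOT: no new estimate; nothing of node NE3 (`hNE3θ` DISPLAYED, node OPEN; c2/c7); no B0 (c5); ROOT B of record UNCHANGED and CONDITIONAL.

HONEST FRAMING (T4-DAG p. 1).  Bookkeeping at MODEL LEVEL on OUR typed objects; constants OURS and UNCHANGED; NE2 (U1a) NOT proved; spine PROVED
0/9 unchanged; rung (B)+1 on one finite T⁴ — NOT infinite volume, NOT mass gap, NOT Clay.  HONEST DEPENDENCY: continuum YM on T⁴ ⇐ BetaPertH ∧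
nine spine estimates (0/9 proved); BetaPertH ⇐ (D1) ∧ (D4) ∧ CAP+tail; G-an2-4 gates asym, D1 and NE2/3/4.  ABSOLUTE RULE kept; no definition,
no `def … : Prop` fact; no `sorry`.
-/

noncomputable section

open scoped BigOperators ComplexConjugate Matrix Matrix.Norms.L2Operator Kronecker

namespace Summit.QuantumFields.BalabanUV.T4Continuum.GaugeTermSlotRegularRate

open Literature.MathematicalPhysics.QuantumFieldTheory.Balaban1983to89.B5Prop11Plancherel (Tor fine Cst)
open Literature.MathematicalPhysics.QuantumFieldTheory.Balaban1983to89.B5Block118 (bpt)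
open Literature.MathematicalPhysics.QuantumFieldTheory.Balaban1983to89.B5Blocks16 (bpt_bijective)
open Literature.MathematicalPhysics.QuantumFieldTheory.Balaban1983to89.B5G183RateUnitTower (lev lev_neZero)
open Literature.MathematicalPhysics.QuantumFieldTheory.Balaban1983to89.T4EtaRateMin (LocalRate)
open Summit.QuantumFields.BalabanUV.T4Continuum
open Summit.QuantumFields.BalabanUV.T4Continuum.BalabanAveragedTowerModes (par)
open Summit.QuantumFields.BalabanUV.T4Continuum.BalabanAveragedTowerUnit (idx one_le_lev' lev_succ' cast_lev')
open Summit.QuantumFields.BalabanUV.T4Continuum.BackgroundResolventTower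
open Summit.QuantumFields.BalabanUV.T4Continuum.KingPairingPlantedLaw
open Summit.QuantumFields.BalabanUV.T4Continuum.NE2FromNE3 (bgReadings consistent_of_localRate)
open Summit.QuantumFields.BalabanUV.T4Continuum.CovariantBlockAveraging (transport leg corner contour)
open Summit.QuantumFields.BalabanUV.T4Continuum.LineAveragingPairing (glue glue_bijective)
open Summit.QuantumFields.BalabanUV.T4Continuum.NestedContourTransport (thetaC theta0)
open Summit.QuantumFields.BalabanUV.T4Continuum.RegularBackgroundTower (RegularTransporters regClass betaNE3 connTower norm_connTower_le
  connTower_lipschitz)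
open Summit.QuantumFields.BalabanUV.T4Continuum.RegularSiteTransporters (siteT siteTr_bpt par_bpt_glue_lev norm_siteT_sub_one_le)
open Summit.QuantumFields.BalabanUV.T4Continuum.GaugeTermScalarData (QuT Q1)
open Summit.QuantumFields.BalabanUV.T4Continuum.GaugeTermInstanceGeom (gS kappaGS)
open Summit.QuantumFields.BalabanUV.T4Continuum.GaugeTermPerturbationLaw (deltaK)
open Summit.QuantumFields.BalabanUV.T4Continuum.ScalarAveragedCompression (sigma0)
open Summit.QuantumFields.BalabanUV.T4Continuum.ScalarCovariantLaplacian (kappaS)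
open Summit.QuantumFields.BalabanUV.T4Continuum.ScalarCovariantLaplacianLawsRate (ConnectionLaws0Rate SiteTransportLaws0Rate)
open Summit.QuantumFields.BalabanUV.T4Continuum.NE2BalabanGauge (gaugeSlot liftR)
open Summit.QuantumFields.BalabanUV.T4Continuum.NE2BalabanFinal (zetaR tauR kappa4F C4F connS_eq_connTower zfieldS_eq_zfieldC)
open Summit.QuantumFields.BalabanUV.T4Continuum.FirstOrderModelRate (rate_nonneg)
open Summit.QuantumFields.BalabanUV.T4Continuum.CovariantLaplacianRate (matrixBoundsRate_of_regular_of_localRate)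
open Summit.QuantumFields.BalabanUV.T4Continuum.AveragingSummandRate (transport_contour_two_level_of_regular_rate thetaC_rate_le_geom
  theta0_eq_affine theta0_zero_nonneg)
open Summit.QuantumFields.BalabanUV.T4Continuum.GaugeTermSlotRate (perturbationLaws_gaugeSlot_balabanData_rate)

variable {d : ℕ} (L : ℕ) [NeZero L] (M : Fin d → ℕ) [hM : ∀ μ, NeZero (M μ)] (a : ℝ) (ha : 0 < a)
variable {o : Type*} [Fintype o] [DecidableEq o]
variable {Rg : (k : ℕ) → Fin d → (Tor (fine (lev L k) M) → Matrix o o ℂ)} {α β C θ : ℝ}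

/-! ## §1 Row B4.e's connection shape AT RATE `θ` from row B5's class and node NE3 at rate `θ` -/

/-- **`ConnectionLaws0Rate` FROM `(hreg, hNE3θ)`** (`d ≥ 1`, `L⁻¹ ≤ θ`): the scalar layer's connection data AT RATE `θ` with `β′ = βNE3 = 2·card o·C`
and `ζ = zetaR o d α β C` — `NE2BalabanFinal.connectionLaws0_of_regular` with node NE3's `LocalRate` read at rate `θ` (row B6's general
`consistent_of_localRate`; the zeroth-order field by part 1's `matrixBoundsRate_of_regular_of_localRate`).  `hNE3θ` DISPLAYED (node NE3 OPEN). [folklore] -/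
theorem connectionLaws0Rate_of_regular (hd : 1 ≤ d) (hreg : RegularTransporters L M (liftR L M Rg) α β) (hC : 0 ≤ C)
    (hθ : ((L : ℝ)⁻¹) ≤ θ) (hNE3θ : LocalRate (bgReadings L M (regClass L M (liftR L M Rg))) C θ) :
    ConnectionLaws0Rate L M Rg α β (betaNE3 o C) (zetaR o d α β C) θ := by
  set κ₀ : Fin d := ⟨0, hd⟩
  obtain ⟨hα, hβ⟩ := hreg.nonneg
  have hθ0 : 0 ≤ θ := rate_nonneg L hθ
  have hb : 0 ≤ betaNE3 o C := by unfold betaNE3; positivity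
  have hw := consistent_of_localRate L M hC hθ0 hNE3θ (Set.mem_insert _ _ : connTower L M (liftR L M Rg) ∈ regClass L M (liftR L M Rg))
  have hz := (matrixBoundsRate_of_regular_of_localRate hreg hC hθ hNE3θ).2
  refine ⟨⟨hα, hβ, hb, by unfold zetaR; positivity⟩, fun k μ x => ?_, fun k μ ν x => ?_, fun k μ x' => ?_, fun k x' => ?_⟩
  · rw [connS_eq_connTower L M Rg k μ x κ₀]
    exact norm_connTower_le hreg k μ (x, κ₀)
  · rw [connS_eq_connTower L M Rg k μ _ κ₀, connS_eq_connTower L M Rg k μ x κ₀]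
    exact connTower_lipschitz hreg k μ ν (x, κ₀)
  · rw [connS_eq_connTower L M Rg (k + 1) μ x' κ₀, connS_eq_connTower L M Rg k μ _ κ₀]
    exact (hw k μ (x', κ₀)).trans (le_of_eq (by unfold betaNE3; ring))
  · rw [zfieldS_eq_zfieldC L M Rg (k + 1) x' κ₀, zfieldS_eq_zfieldC L M Rg k _ κ₀]
    exact hz.consistent k (x', κ₀)

/-! ## §2 The site transports' two-spacing consistency AT RATE `θ` and row B4.e's site-transport shape -/

/-- **TWO-LEVEL CONSISTENCY OF BAŁABAN's SITE TRANSPORTS AT RATE `θ`, per site** (`d ≥ 1`, `L⁻¹ ≤ θ`):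
`‖T^{(k+1)}(x′) − T^{(k)}(par x′)‖ ≤ θ₀(d, α, βNE3)·θ^k` — leaf-03's `norm_siteT_succ_sub_par_le` (contour transport along the (1.7) legs at zero line
bonds) re-run on part 2's `transport_contour_two_level_of_regular_rate`, then `thetaC_rate_le_geom` (SAME `theta0`).  `hNE3θ` DISPLAYED. [folklore] -/
theorem norm_siteT_succ_sub_par_le_rate (hd : 1 ≤ d) (hreg : RegularTransporters L M (liftR L M Rg) α β) (hC : 0 ≤ C)
    (hθ : ((L : ℝ)⁻¹) ≤ θ) (hNE3θ : LocalRate (bgReadings L M (regClass L M (liftR L M Rg))) C θ)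
    (k : ℕ) (x' : Tor (fine (lev L (k + 1)) M)) :
    ‖siteT L M Rg (k + 1) x' - siteT L M Rg k (par (lev L k) L M x')‖ ≤ theta0 d α (betaNE3 o C) * θ ^ k := by
  have hθ0 : 0 ≤ θ := rate_nonneg L hθ
  obtain ⟨⟨y, j'⟩, rfl⟩ := (bpt_bijective (lev L (k + 1)) M).2 x'
  obtain ⟨⟨j, r⟩, rfl⟩ := (glue_bijective (d := d) (lev L k) L).2 j'
  dsimp only
  rw [par_bpt_glue_lev hd k y j r, siteT, siteT, siteTr_bpt (lev L (k + 1)) M (Rg (k + 1)) y _ ⟨0, hd⟩,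
    siteTr_bpt (lev L k) M (Rg k) y j ⟨0, hd⟩]
  have h := transport_contour_two_level_of_regular_rate L M hreg hC hθ0 hNE3θ k y ⟨0, hd⟩ j r 0
    (Nat.mul_pos (Nat.pos_of_ne_zero (NeZero.ne L)) (one_le_lev' L k))
  simp only [Nat.add_zero, Nat.div_eq_of_lt (r ⟨0, hd⟩).isLt] at h
  exact h.trans (thetaC_rate_le_geom (o := o) (L := L) (d := d) hreg.nonneg.1 hC hθ k)

omit hM [DecidableEq o] in
/-- `θ₀(d, α, β) ≥ 0` for `α, β ≥ 0` (part 2's affine split of leaf-06's closed form). [folklore] -/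
theorem theta0_nonneg {α β : ℝ} (hα : 0 ≤ α) (hβ : 0 ≤ β) : 0 ≤ theta0 d α β := by
  rw [theta0_eq_affine]
  have := theta0_zero_nonneg d hα
  positivity

/-- **ROW B4.e's SITE-TRANSPORT SHAPE AT RATE `θ` FOR THE DETERMINED SITE TRANSPORTERS, FROM `(hreg, hNE3θ)`** (`d ≥ 1`, `L⁻¹ ≤ θ`):
`SiteTransportLaws0Rate L M (siteT L M Rg) (tauR d α) (theta0 d α βNE3) θ` — twin of leaf-03's `siteTransportLaws0_of_regular`. [folklore] -/
theorem siteTransportLaws0Rate_of_regular (hd : 1 ≤ d) (hreg : RegularTransporters L M (liftR L M Rg) α β) (hC : 0 ≤ C)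
    (hθ : ((L : ℝ)⁻¹) ≤ θ) (hNE3θ : LocalRate (bgReadings L M (regClass L M (liftR L M Rg))) C θ) :
    SiteTransportLaws0Rate L M (siteT L M Rg) (tauR d α) (theta0 d α (betaNE3 o C)) θ where
  nonneg := ⟨sub_nonneg.mpr (Real.one_le_exp (mul_nonneg (Nat.cast_nonneg _) hreg.nonneg.1)),
    theta0_nonneg (d := d) hreg.nonneg.1 (by unfold betaNE3; positivity)⟩
  sub_one_le := fun k x => norm_siteT_sub_one_le hd hreg k x
  consistent := fun k x' => norm_siteT_succ_sub_par_le_rate L M hd hreg hC hθ hNE3θ k x'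

/-! ## §3 The face PART 4 composes with -/

/-- **THE B4 GAUGE SLOT AT A GENERAL RATE `θ` FROM THE CLASS, NODE NE3 AT RATE `θ` AND THE HYPOTHESIS-FREE SCALAR TOWER**
(`d ≥ 1`, `a′ > 0`, `L⁻¹ ≤ θ ≤ 1`): `PerturbationLaws (Δ_a ⊗ 1) (gaugeSlot Rg (QuT (siteT Rg)) Q1 a′) (J ⊗ 1) κ₄ (C₄·θ^k)` with leaf-08's letters
`κ₄ = kappa4F d a a′ α β`, `C₄ = C4F o d L a a′ α β C` UNCHANGED — 3b-2's `perturbationLaws_gaugeSlot_balabanData_rate` at the read-outs of §1/§2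
(`NE2BalabanFinal.perturbationLaws_gaugeSlot_regular` is the case `θ = L⁻¹`, see the `example` below).  Displayed: `hreg`, `hNE3θ` (node NE3 OPEN),
the numeric `kappaS … < 1`, `σ₀⁻²·δK < 1`; `hθle : θ ≤ 1` feeds leaf-08's `nuL_le_geom` (`θ^{2k} ≤ θ^k`).  NE2 is NOT proved by this.
[cite: Balaban1985BackgroundPropagators, (3.19) p.393, (3.25) p.394, (3.26) p.395 (shapes)] [folklore] -/
theorem perturbationLaws_gaugeSlot_regular_rate (hd : 1 ≤ d) (hreg : RegularTransporters L M (liftR L M Rg) α β) (hC : 0 ≤ C)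
    (hθ : ((L : ℝ)⁻¹) ≤ θ) (hθle : θ ≤ 1) (hNE3θ : LocalRate (bgReadings L M (regClass L M (liftR L M Rg))) C θ) {a' : ℝ} (ha' : 0 < a')
    (hκ : kappaS d a' α β (tauR d α) < 1)
    (hsmall : ((sigma0 d a') ^ 2)⁻¹ * deltaK (gS d a' (kappaS d a' α β (tauR d α))) (1 + tauR d α) (d * α) (tauR d α) a' < 1) :
    PerturbationLaws (fun k => calDalev L M a ha k ⊗ₖ (1 : Matrix o o ℂ))
      (gaugeSlot L M Rg (QuT L M o (siteT L M Rg)) (Q1 L M o) a')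
      (fun k => JpcT L M k ⊗ₖ (1 : Matrix o o ℂ)) (kappa4F d a a' α β)
      (fun k => C4F o d L a a' α β C * θ ^ k) :=
  perturbationLaws_gaugeSlot_balabanData_rate L M a ha hd ha' (connectionLaws0Rate_of_regular L M hd hreg hC hθ hNE3θ)
    (siteTransportLaws0Rate_of_regular L M hd hreg hC hθ hNE3θ) hθ hθle hκ hsmall

/-- **THE INSTANCE OF RECORD IS THE CASE `θ = L⁻¹` (kernel)**: at `θ = L⁻¹` this face has EXACTLY the type of
`NE2BalabanFinal.perturbationLaws_gaugeSlot_regular L M a ha hd hreg hC hNE3 ha′ hκ hsmall`. -/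
example (hd : 1 ≤ d) (hreg : RegularTransporters L M (liftR L M Rg) α β) (hC : 0 ≤ C)
    (hNE3 : LocalRate (bgReadings L M (regClass L M (liftR L M Rg))) C ((L : ℝ)⁻¹)) {a' : ℝ} (ha' : 0 < a')
    (hκ : kappaS d a' α β (tauR d α) < 1)
    (hsmall : ((sigma0 d a') ^ 2)⁻¹ * deltaK (gS d a' (kappaS d a' α β (tauR d α))) (1 + tauR d α) (d * α) (tauR d α) a' < 1) :
    PerturbationLaws (fun k => calDalev L M a ha k ⊗ₖ (1 : Matrix o o ℂ))
      (gaugeSlot L M Rg (QuT L M o (siteT L M Rg)) (Q1 L M o) a')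
      (fun k => JpcT L M k ⊗ₖ (1 : Matrix o o ℂ)) (kappa4F d a a' α β)
      (fun k => C4F o d L a a' α β C * ((L : ℝ)⁻¹) ^ k) :=
  perturbationLaws_gaugeSlot_regular_rate L M a ha hd hreg hC le_rfl
    (inv_le_one_of_one_le₀ (by exact_mod_cast Nat.one_le_iff_ne_zero.mpr (NeZero.ne L))) hNE3 ha' hκ hsmall

end Summit.QuantumFields.BalabanUV.T4Continuum.GaugeTermSlotRegularRate

end
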